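import Summits.RiemannHypothesis.RiemannHypothesis.Theorems.LiDirichletEchoImContour
import Summits.RiemannHypothesis.RiemannHypothesis.Theorems.LiDirichletEchoLiHorizontalEdgesChar
import HarnessLib

/-!
# RiemannHypothesis / LiDirichletEcho — complex companion, part 4: the REAL parts of the horizontal edges at good heights
# (RH-FREE, GRH-FREE)

RH-FREE · GRH-FREE [rh-li-eng g5].  Towards `LiTheory.LiZeroWindowEchoDirichletComplex` (imaginary channel).  The antisymmetric
contour identity (`ImContourChar.im_window_contour`) carries the horizontal edges through the REAL parts `charHorizRe χ n T` of
the same segment integrals whose imaginary parts are `charHorizTerm χ n T`; K3χ (`Theorems/LiDirichletEchoLiHorizontalEdgesChar.lean`)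
bounded the NORM of those integrals, so the same good height `T' ∈ [T, T + 1]` (MV Lemma 12.7) serves both channels:
for primitive `χ` mod `q > 1`, `c ≥ 1`, `n ≥ N`, `T ∈ [√n, c√n]` there is `T' ∈ [T, T+1] ∩ charGoodHeights χ` with
`|charHorizTerm χ n T'| ≤ C log² n` and `|charHorizRe χ n T'| ≤ C log² n`.  Nothing here bears on the truth of RH or GRH.
-/

noncomputable section

-- D-0017: `Summit.<S>.<S>.…` is the designed namespace of a single-problem summit.
set_option linter.dupNamespace false

open Complex MeasureTheory intervalIntegral Set
open scoped Interval ComplexConjugate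

namespace Summit.RiemannHypothesis.RiemannHypothesis.Theorems.LiTheory

open Literature.NumberTheory.LFunctions Literature.NumberTheory.LFunctions.DirichletTheta
  Literature.NumberTheory.LFunctions.ExplicitPsiChar

namespace ImHorizontalChar

open HorizontalEdges HorizontalEdgesChar

/-- **Segment bound, both channels.**  There is an absolute `C ≥ 0` such that for primitive `χ` mod `q > 1`, `T ≥ 2`,
`T ≥ √n`, `0 < η ≤ 1` with every non-trivial zero of `L(s, χ)` at distance `≥ η` from the ordinate `T`:
`T ∈ charGoodHeights χ`, `|charHorizTerm χ n T| ≤ Cℒ/η` and `|charHorizRe χ n T| ≤ Cℒ/η`, `ℒ = log q + log(|T| + 4)`. -/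
theorem horiz_pointwise_both :
    ∃ C : ℝ, 0 ≤ C ∧ ∀ (q : ℕ) [NeZero q] (χ : DirichletCharacter ℂ q), χ.IsPrimitive → 1 < q →
      ∀ (n : ℕ) (T η : ℝ), 2 ≤ T → Real.sqrt n ≤ T → 0 < η → η ≤ 1 →
      (∀ ρ : ℂ, χ.LFunction ρ = 0 → 0 < ρ.re → ρ.re < 1 → η ≤ |ρ.im - T|) →
        T ∈ charGoodHeights χ ∧ |charHorizTerm χ n T| ≤ C * (Real.log q + Real.log (|T| + 4)) / η
          ∧ |charHorizRe χ n T| ≤ C * (Real.log q + Real.log (|T| + 4)) / η := by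
  -- as `HorizontalEdgesChar.horiz_pointwise` (same norm bound of the segment integral, read in both channels)
  obtain ⟨C, hC, hseg⟩ := exists_norm_logDeriv_dirichletXi_le
  refine ⟨2 * C, by positivity, fun q _ χ hχ hq n T η hT2 hTn hη0 hη1 hZ ↦ ?_⟩
  have h1 : χ ≠ 1 := ne_one_of_isPrimitive hχ hq
  have hT0 : 0 < T := by linarith
  have hTabs : 2 ≤ |T| := by rw [abs_of_pos hT0]; exact hT2
  have hseg' := hseg q χ hχ hq T η hTabs hη0 hη1 hZ
  have hq1 : (1 : ℝ) ≤ q := by exact_mod_cast NeZero.one_le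
  have hlogq : 0 ≤ Real.log q := Real.log_nonneg hq1
  have hlog0 : 0 ≤ Real.log (|T| + 4) := Real.log_nonneg (by linarith [abs_nonneg T])
  have hnT : (n : ℝ) ≤ T ^ 2 := by
    have h := Real.sq_sqrt (n.cast_nonneg : (0 : ℝ) ≤ n)
    nlinarith [Real.sqrt_nonneg (n : ℝ)]
  set K : ℝ := C * (Real.log q + Real.log (|T| + 4)) / η with hK
  have hK0 : 0 ≤ K := by positivity
  have hpt : ∀ x ∈ Ι (-(1 / 2 : ℝ)) (3 / 2),
      ‖logDeriv (dirichletXi χ) (x + T * I) * liWeight n (x + T * I)‖ ≤ K * Real.exp 1 := by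
    intro x hx
    rw [uIoc_of_le (by norm_num)] at hx
    rw [norm_mul]
    exact mul_le_mul (hseg' x ⟨hx.1.le, hx.2⟩) (norm_liWeight_le_exp n hx.1.le hT0 hnT) (norm_nonneg _) hK0
  have hI := intervalIntegral.norm_integral_le_of_norm_le_const hpt
  have hlen : |(3 / 2 : ℝ) - -(1 / 2)| = 2 := by norm_num
  rw [hlen] at hI
  set J : ℂ := ∫ x in (-(1 / 2 : ℝ))..(3 / 2 : ℝ), logDeriv (dirichletXi χ) (x + T * I) * liWeight n (x + T * I) with hJ
  have hπ : 1 / Real.pi ≤ 1 / 3 := one_div_le_one_div_of_le (by norm_num) Real.pi_gt_three.le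
  have he : Real.exp 1 < 3 := lt_trans Real.exp_one_lt_d9 (by norm_num)
  have hbound : ∀ r : ℝ, |r| ≤ ‖J‖ → 1 / Real.pi * |r| ≤ 2 * C * (Real.log q + Real.log (|T| + 4)) / η := by
    intro r hr
    calc 1 / Real.pi * |r| ≤ 1 / 3 * (K * Real.exp 1 * 2) := mul_le_mul hπ (hr.trans hI) (abs_nonneg _) (by norm_num)
      _ ≤ 2 * C * (Real.log q + Real.log (|T| + 4)) / η := by
          rw [show 2 * C * (Real.log q + Real.log (|T| + 4)) / η = K * 2 by rw [hK]; ring]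
          nlinarith
  refine ⟨?_, ?_, ?_⟩
  · intro x _ h0
    have hmem := (dirichletXi_eq_zero_iff_mem_charNontrivialZeros hχ h1 _).1 h0
    obtain ⟨hL, hre, hre1⟩ := mem_charNontrivialZeros.1 hmem
    have h := hZ _ hL hre hre1
    simp at h
    linarith
  · unfold charHorizTerm
    rw [abs_mul, abs_of_pos (by positivity : (0 : ℝ) < 1 / Real.pi)]
    exact hbound _ (Complex.abs_im_le_norm J)
  · unfold charHorizRe
    rw [abs_mul, abs_of_pos (by positivity : (0 : ℝ) < 1 / Real.pi)]
    exact hbound _ (Complex.abs_re_le_norm J)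

end ImHorizontalChar

open HorizontalEdgesChar ImHorizontalChar in
/-- **Good heights serving both channels** (RH-FREE, GRH-FREE): for primitive `χ` mod `q > 1` and `c ≥ 1` there are `N`, `C`
with: for `n ≥ N` and `T ∈ [√n, c√n]` some good height `T' ∈ [T, T+1]` has `|charHorizTerm χ n T'| ≤ C log² n` and
`|charHorizRe χ n T'| ≤ C log² n`. -/
theorem charHorizBoth_bound {q : ℕ} [NeZero q] (χ : DirichletCharacter ℂ q) (hχ : χ.IsPrimitive) (hq : 1 < q) :
    ∀ c : ℝ, 1 ≤ c → ∃ N : ℕ, ∃ C : ℝ, ∀ n : ℕ, N ≤ n → ∀ T : ℝ, Real.sqrt n ≤ T → T ≤ c * Real.sqrt n →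
      ∃ T' : ℝ, T ≤ T' ∧ T' ≤ T + 1 ∧ T' ∈ charGoodHeights χ ∧ |charHorizTerm χ n T'| ≤ C * Real.log n ^ 2
        ∧ |charHorizRe χ n T'| ≤ C * Real.log n ^ 2 := by
  intro c hc
  obtain ⟨N, A, hN⟩ := goodHeight_log hχ hq c hc
  obtain ⟨C, hC0, hP⟩ := horiz_pointwise_both
  refine ⟨max N 4, C * A, fun n hn T hT1 hT2 ↦ ?_⟩
  have hnN : N ≤ n := le_trans (le_max_left _ _) hn
  have hn4 : (4 : ℝ) ≤ n := by exact_mod_cast le_trans (le_max_right _ _) hn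
  have hs2 : 2 ≤ Real.sqrt n := by
    have : Real.sqrt 4 = 2 := by
      rw [show (4 : ℝ) = 2 ^ 2 by norm_num]; exact Real.sqrt_sq (by norm_num)
    rw [← this]; exact Real.sqrt_le_sqrt hn4
  obtain ⟨T', η, hTT', hT'1, hη0, hη1, hlog, hsep⟩ := hN n hnN T hT1 hT2
  obtain ⟨hgood, hbd, hbd'⟩ := hP q χ hχ hq n T' η (by linarith) (by linarith) hη0 hη1 hsep
  have hmul : C * (Real.log q + Real.log (|T'| + 4)) / η ≤ C * A * Real.log n ^ 2 := by
    rw [mul_div_assoc, mul_assoc]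
    exact mul_le_mul_of_nonneg_left hlog hC0
  exact ⟨T', hTT', hT'1, hgood, hbd.trans hmul, hbd'.trans hmul⟩

end Summit.RiemannHypothesis.RiemannHypothesis.Theorems.LiTheory

end
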